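import Summits.CriticalPhenomena.PercolationContinuityZ3.Theorems.PercNearOneGluingNoHeavyRsw3VolumeHyperscaling
import Summits.CriticalPhenomena.PercolationContinuityZ3.Theorems.PercNearOneGluingNoHeavyRsw3SetToSetGatedDomainTools
import HarnessLib

/-!
# RSW3 lane (P2, gen 19): INNER-CLUSTER EVENTS AND THE FAR ARM, I — the exit events `Exit_C(T)` of Duminil-Copin–Tassion's
# exploration decomposition: concatenation, the exploration step, locality and independence from `{𝒞 = C}` (every `p`)

builds on p205010 (kernel theorem, internal audit signed; external expert review pending) — NOT used in this file.

Cell `prim-rsw3`, prover seat `prim-rsw3-p2` (gen 19), memo `run/shared/lean/prim/rsw3/P2-RSWLITE.md` §26 (V73, Step 1).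
Support file (`--supports stmt-CriticalPhenomena-4575`); no definitions, no named facts, no sorries.

Let `S = Λ(m−1)`, `𝒞(ω)` = the cluster of `0` inside `S` (the Literature library's `DCT16.clusterSet S ω`), and let `F` be an event
depending on `ω` only through `𝒞(ω)`.  Duminil-Copin–Tassion's exploration decomposition (`DCT16.exists_decomposition`: last visit `x`
of an arm to `𝒞 = C`, an open edge `xy` with `y ∉ S`, then `y ↔ target` inside `Λ(N) ∖ C`; the three pieces live on disjoint sets of
pairs) is combined with Basu–Sapozhnikov's (A2)□ IN THE DOMAIN `Z = Λ(N) ∖ C` (allowed: `C ⊆ Λ(m−1)`) applied to the random set of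
activated exit sites:

* `clusterEvent_inter_exitUnion_subset` — concatenation: on `{𝒞 = C}`, an activated exit site joined to `T` inside `Λ(N) ∖ C` joins `0` to `T`;
* `mem_exitUnion_of_clusterEvent_of_siteToBoundary` — the exploration step (a.s.): on `{𝒞 = C} ∩ {0 ↔ ∂ⁱⁿΛ(N')}` some exit site is
  activated and joined to `∂ⁱⁿΛ(N')` inside `Λ(N) ∖ C` (`N' ≤ N`);
* `real_clusterEvent_inter_exitUnion` — independence: `P({𝒞 = C} ∩ Exit_C(T)) = P(𝒞 = C)·P(Exit_C(T))`;
The (A2)□ step and the transfer inequality are in `…Rsw3InnerClusterTransfer.lean`.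

References: H. Duminil-Copin, V. Tassion, Enseign. Math. 62 (2016), §2.1 (the exploration decomposition) [DuminilCopinTassionEM2016];
D. Basu, A. Sapozhnikov, ECP 22 (2017), §1 (A2) and §2 [BasuSapozhnikov2017ECP]; H. Kesten, PTRF 73 (1986) (IIC) [Kesten1986];
G. Grimmett, *Percolation* (1999), §2.2 [GrimmettPercolation1999]. [folklore]
-/

noncomputable section

namespace Summit.CriticalPhenomena.PercolationContinuityZ3.Theorems

namespace Rsw3

open MeasureTheory Literature.Probability.LatticeModels Literature.Probability.Percolation
open SurfaceTension Crossing SimpleGraph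

variable {d : ℕ}

/-! ## The exit events `Exit_C(T)` -/

/-- **Concatenation** (all `ω`): if `𝒞(ω) = C` (cluster of `0` inside `Λ(m−1)`), `x ∈ C`, `xy` is an open lattice edge with `y ∈ Λ(m)`,
and `y ↔ T` inside `Λ(N) ∖ C` (`m ≤ N`), then `0 ↔ T` inside `Λ(N)`. [cite: DuminilCopinTassionEM2016, §2.1] -/
theorem clusterEvent_inter_exitUnion_subset {m N : ℕ} (hmN : m ≤ N) (C T : Finset (Site d)) :
    DCT16.clusterEvent (box d (m - 1)) C ∩
        {ω | ∃ x ∈ C, ∃ y ∈ box d m \ box d (m - 1), (zdGraph d).Adj x y ∧ s(x, y) ∈ ω ∧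
          ∃ t ∈ T, ω ∈ openConnIn ((↑(box d N \ C) : Set (Site d))) y t} ⊆
      {ω | ∃ x ∈ ({(0 : Site d)} : Finset (Site d)), ∃ t ∈ T, ω ∈ openConnIn (↑(box d N) : Set (Site d)) x t} := by
  rintro ω ⟨hC, x, hx, y, hy, hxy, hopen, t, ht, hyt⟩
  refine ⟨0, Finset.mem_singleton_self _, t, ht, ?_⟩
  have hSN : (↑(box d (m - 1)) : Set (Site d)) ⊆ ↑(box d N) := Finset.coe_subset.2 (box_mono d (by omega))
  -- `0 ↔ x in Λ(m-1)`
  have h0x : ω ∈ openConnIn (↑(box d N) : Set (Site d)) 0 x := by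
    have : x ∈ DCT16.clusterSet (box d (m - 1)) ω := by
      rw [show DCT16.clusterSet (box d (m - 1)) ω = ↑C from hC]; exact hx
    exact openConnIn_mono hSN 0 x this
  -- the edge `xy`
  have hxN : x ∈ (↑(box d N) : Set (Site d)) := hSN (DCT16.clusterSet_subset _ ω (by
    rw [show DCT16.clusterSet (box d (m - 1)) ω = ↑C from hC]; exact hx))
  have hyN : y ∈ (↑(box d N) : Set (Site d)) := Finset.mem_coe.2 (box_mono d hmN (Finset.mem_sdiff.1 hy).1)
  have hxy' : ω ∈ openConnIn (↑(box d N) : Set (Site d)) x y := by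
    refine ⟨hxN, hyN, SimpleGraph.Adj.reachable ?_⟩
    simp only [SimpleGraph.comap_adj, Function.Embedding.subtype_apply, openGraph_adj]
    exact ⟨hopen, hxy.ne⟩
  -- `y ↔ t in Λ(N) ∖ C ⊆ Λ(N)`
  have hyt' : ω ∈ openConnIn (↑(box d N) : Set (Site d)) y t :=
    openConnIn_mono (by rw [Finset.coe_sdiff]; exact Set.sdiff_subset) y t hyt
  exact GM.openConnIn_trans (GM.openConnIn_trans h0x hxy') hyt'

/-- **Exploration step** (Duminil-Copin–Tassion; configurations on lattice edges): if `𝒞(ω) = C` and `0 ↔ ∂ⁱⁿΛ(N')` with `m ≤ N' ≤ N`,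
`1 ≤ m`, then some `x ∈ C` has an open lattice edge to a site `y ∈ Λ(m) ∖ Λ(m−1)` joined to `∂ⁱⁿΛ(N')` inside `Λ(N) ∖ C`.
[cite: DuminilCopinTassionEM2016, §2.1] -/
theorem mem_exitUnion_of_clusterEvent_of_siteToBoundary {m N' N : ℕ} (hm : 1 ≤ m) (hmN' : m ≤ N') (hN'N : N' ≤ N)
    {C : Finset (Site d)} {ω : BondConfig (Site d)} (hω : ω ⊆ (zdGraph d).edgeSet)
    (hC : ω ∈ DCT16.clusterEvent (box d (m - 1)) C) (harm : ω ∈ siteToBoundary d N') :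
    ω ∈ {ω | ∃ x ∈ C, ∃ y ∈ box d m \ box d (m - 1), (zdGraph d).Adj x y ∧ s(x, y) ∈ ω ∧
      ∃ t ∈ innerBoundary (zdGraph d) (box d N'), ω ∈ openConnIn ((↑(box d N \ C) : Set (Site d))) y t} := by
  classical
  have h0 : (0 : Site d) ∈ box d (m - 1) := zero_mem_box d _
  obtain ⟨x, hxS, y, hy, hyS, C', hC', hxC', hcl, hopen, hexit⟩ :=
    DCT16.exists_decomposition h0 (subset_refl (box d (m - 1))) (by omega : m - 1 < N') hω harm
  -- `C' = C`
  have hCC' : C' = C := by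
    apply Finset.coe_injective
    have h1 : DCT16.clusterSet (box d (m - 1)) ω = ↑C' := hcl
    have h2 : DCT16.clusterSet (box d (m - 1)) ω = ↑C := hC
    rw [← h1, h2]
  subst hCC'
  have hxy : (zdGraph d).Adj x y := by simpa using hy
  refine ⟨x, hxC', y, ?_, hxy, hopen, ?_⟩
  · rw [Finset.mem_sdiff]
    refine ⟨?_, hyS⟩
    have := DCT16.mem_box_succ_of_adj hxS hxy
    rwa [Nat.sub_add_cancel hm] at this
  · obtain ⟨z, hz, hyz⟩ := hexit
    refine ⟨z, hz, openConnIn_mono ?_ y z hyz⟩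
    rw [Finset.coe_sdiff]
    exact Set.sdiff_subset_sdiff_left (Finset.coe_subset.2 (box_mono d hN'N))

/-- The exit event `Exit_C(T)` is determined by the pairs off `clusterPairs (Λ(m−1)) C`: the edges `xy` (`x ∈ C`, `y ∉ Λ(m−1)`) and the
pairs of `Λ(N) ∖ C`. [cite: DuminilCopinTassionEM2016, §2.1] -/
theorem determinedBy_exitUnion (m N : ℕ) (C T : Finset (Site d)) :
    DeterminedBy {ω : BondConfig (Site d) | ∃ x ∈ C, ∃ y ∈ box d m \ box d (m - 1), (zdGraph d).Adj x y ∧ s(x, y) ∈ ω ∧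
        ∃ t ∈ T, ω ∈ openConnIn ((↑(box d N \ C) : Set (Site d))) y t}
      (↑(((C ×ˢ (box d m \ box d (m - 1))).image fun q => s(q.1, q.2)) ∪ (box d N \ C).sym2) : Set (Sym2 (Site d))) := by
  classical
  have h : {ω : BondConfig (Site d) | ∃ x ∈ C, ∃ y ∈ box d m \ box d (m - 1), (zdGraph d).Adj x y ∧ s(x, y) ∈ ω ∧
        ∃ t ∈ T, ω ∈ openConnIn ((↑(box d N \ C) : Set (Site d))) y t} =
      ⋃ x ∈ C, ⋃ y ∈ (box d m \ box d (m - 1)).filter (fun y => (zdGraph d).Adj x y),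
        ({ω : BondConfig (Site d) | s(x, y) ∈ ω} ∩ ⋃ t ∈ T, openConnIn ((↑(box d N \ C) : Set (Site d))) y t) := by
    ext ω
    simp only [Set.mem_setOf_eq, Set.mem_iUnion, Set.mem_inter_iff, Finset.mem_filter, exists_prop]
    constructor
    · rintro ⟨x, hx, y, hy, hxy, ho, t, ht, hyt⟩
      exact ⟨x, hx, y, ⟨hy, hxy⟩, ho, t, ht, hyt⟩
    · rintro ⟨x, hx, y, ⟨hy, hxy⟩, ho, t, ht, hyt⟩
      exact ⟨x, hx, y, hy, hxy, ho, t, ht, hyt⟩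
  rw [h, Finset.coe_union]
  refine DeterminedBy.iUnion fun x => DeterminedBy.iUnion fun hx => DeterminedBy.iUnion fun y => DeterminedBy.iUnion fun hy => ?_
  refine DeterminedBy.inter ?_ ?_
  · refine (determinedBy_mem (s(x, y))).mono ?_
    intro e he
    rw [Set.mem_singleton_iff] at he
    subst he
    refine Or.inl (Finset.mem_coe.2 (Finset.mem_image.2 ⟨(x, y), ?_, rfl⟩))
    exact Finset.mem_product.2 ⟨hx, (Finset.mem_filter.1 hy).1⟩
  · refine DeterminedBy.iUnion fun t => DeterminedBy.iUnion fun _ => ?_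
    refine (DCT16.determinedBy_openConnIn _ y t (K := ↑(box d N \ C).sym2) (by rw [Finset.coe_sym2])).mono ?_
    exact Set.subset_union_right

/-- The support of the exit event is disjoint from `clusterPairs (Λ(m−1)) C`. [cite: DuminilCopinTassionEM2016, §2.1] -/
theorem disjoint_clusterPairs_exitSupport (m N : ℕ) (C : Finset (Site d)) :
    Disjoint (DCT16.clusterPairs (box d (m - 1)) C)
      (((C ×ˢ (box d m \ box d (m - 1))).image fun q => s(q.1, q.2)) ∪ (box d N \ C).sym2) := by
  classical
  rw [Finset.disjoint_left]
  intro e he he'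
  simp only [DCT16.clusterPairs, Finset.mem_sdiff] at he
  rcases Finset.mem_union.1 he' with h1 | h2
  · obtain ⟨q, hq, rfl⟩ := Finset.mem_image.1 h1
    obtain ⟨-, hq2⟩ := Finset.mem_product.1 hq
    have := (Finset.mk_mem_sym2_iff.1 he.1).2
    exact (Finset.mem_sdiff.1 hq2).2 this
  · induction e using Sym2.ind with
    | _ a b =>
      have hab := Finset.mk_mem_sym2_iff.1 he.1
      have hab' := Finset.mk_mem_sym2_iff.1 h2
      rw [Finset.mem_sdiff, Finset.mem_sdiff] at hab'
      apply he.2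
      rw [Finset.mk_mem_sym2_iff, Finset.mem_sdiff, Finset.mem_sdiff]
      exact ⟨⟨hab.1, hab'.1.2⟩, ⟨hab.2, hab'.2.2⟩⟩

/-- **Independence of the exploration pieces**: `P({𝒞 = C} ∩ Exit_C(T)) = P(𝒞 = C)·P(Exit_C(T))`.
[cite: DuminilCopinTassionEM2016, §2.1 ("the three events depend on different sets of edges")] -/
theorem real_clusterEvent_inter_exitUnion (p : unitInterval) (m N : ℕ) (C T : Finset (Site d)) :
    (bondPercolation (zdGraph d) p).real (DCT16.clusterEvent (box d (m - 1)) C ∩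
        {ω | ∃ x ∈ C, ∃ y ∈ box d m \ box d (m - 1), (zdGraph d).Adj x y ∧ s(x, y) ∈ ω ∧
          ∃ t ∈ T, ω ∈ openConnIn ((↑(box d N \ C) : Set (Site d))) y t}) =
      (bondPercolation (zdGraph d) p).real (DCT16.clusterEvent (box d (m - 1)) C) *
        (bondPercolation (zdGraph d) p).real
          {ω | ∃ x ∈ C, ∃ y ∈ box d m \ box d (m - 1), (zdGraph d).Adj x y ∧ s(x, y) ∈ ω ∧
            ∃ t ∈ T, ω ∈ openConnIn ((↑(box d N \ C) : Set (Site d))) y t} := by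
  have h0 : (0 : Site d) ∈ box d (m - 1) := zero_mem_box d _
  exact DCT16.real_inter_of_determinedBy_disjoint (zdGraph d) p (DCT16.determinedBy_clusterEvent (C := C) h0)
    (determinedBy_exitUnion m N C T) (disjoint_clusterPairs_exitSupport m N C)

end Rsw3

end Summit.CriticalPhenomena.PercolationContinuityZ3.Theorems
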